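import Literature.Probability.RandomPlanarGeometry.OneSidedExcursionCloudMeasure
import Literature.Probability.RandomPlanarGeometry.RestrictionMeasuresFiveEighthsOneSided
import HarnessLib

/-!
# `P⁺_{5/8}{i ∉ K} = 1/2` unconditionally; [LSW] Cor. 8.6 without §8, and p. 5 results 1–2 from the three §7 leaves

Proof-only companion (no definition, no named fact) of `OneSidedRestriction` /
`OneSidedRestrictionFacts` / `OneSidedRestrictionProofs` for the named fact
`Literature.Probability.RandomPlanarGeometry.exists_isRightRestrictionMeasure_lt_five_eighths`
("for `0 < α < 5/8`, `P⁺_α` exists and `P⁺_α{i ∉ K} > 1/2`", the input of [LSW] Cor. 8.6), after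

* G. F. Lawler, O. Schramm, W. Werner, *Conformal restriction: the chordal case*, J. Amer. Math.
  Soc. **16** (2003) 917–955, arXiv:math/0209343 (**[LSW]**), proof of Cor. 8.6 (p. 38): "the
  probability that `i` ends up eventually to 'the right' of the right hand boundary […] is
  strictly larger than the corresponding quantity for SLE(8/3, 0), which is `1/2` by symmetry";
* G. F. Lawler, *Conformally Invariant Processes in the Plane*, AMS (2005) (**[Law05]**), proof of
  Cor. 9.11 (p. 219): "`q(α)` is strictly increasing in `α`. Since the hull corresponding to
  `α = 5/8` is an SLE_{8/3} curve, and the distribution of SLE_{8/3} is symmetric about the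
  imaginary axis, `q(5/8) = 1/2`. Hence `q(α) < 1/2` for `α < 5/8`."

State of the tree used here. `P_{5/8}` exists unconditionally and every `P_{5/8}` is the law of
the SLE_{8/3} curve (`exists_isRestrictionMeasure_five_eighths`,
`IsRestrictionMeasure.measure_setOf_I_mem_eq_zero_of_five_eighths`: `P_{5/8}(i ∈ K) = 0`);
`F^{ℝ₊}_ℍ(P_α) = P⁺_α` (`IsRestrictionMeasure.map_leftFillConfig`) and
`2 · P_α(i right of K) + P_α(i ∈ K) = 1` (`IsRestrictionMeasure.two_mul_measure_rightOf_I_add`);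
Lawler's argument with its inputs (2) `q(5/8) = 1/2` and (3) small-`β` positivity as hypotheses
(`IsRightRestrictionMeasure.one_half_lt_measure_notMem_I_of_pos`,
`exists_isRightRestrictionMeasure_lt_five_eighths_of_exists_of_pos`); the excursion-cloud
construction of `P⁺_β` charging `i` from a two-sided `P_1` with interior points
(`ExcursionCloud.exists_isRightRestrictionMeasure_of_exists_one`,
`ExcursionCloud.small_exponent_positivity`, [Law05] §9.2 Prop. 9.13). This file PROVES:

* `IsRightRestrictionMeasure.measure_I_notMem_eq_half_of_five_eighths` — **`q(5/8) = 1/2`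
  unconditionally**: every right-sided restriction measure of exponent `5/8` gives `{i ∉ K}`
  probability exactly `1/2` (it is `F^{ℝ₊}_ℍ(P_{5/8})` by uniqueness, and `2r + 0 = 1`);
* hence the fact, the asymmetry for every `P⁺_α` (`α < 5/8`) and **Cor. 8.6 from TWO one-sided
  inputs only** — existence of all `P⁺_β` ([LSW] Prop. 8.1, the named fact
  `exists_isRightRestrictionMeasure`) and the small-`β` positivity `P⁺_β{i ∉ K} < 1`
  (`…_of_exists_of_pos'`, `not_exists_isRestrictionMeasure_of_lt_five_eighths_of_exists_of_pos`);
  and p. 5 result 2 with `LawlerSchrammWerner2003` from existence and the small-`β` INTERIOR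
  positivity (`…_of_exists_of_intPos`, through `IsRestrictionMeasure.eq_five_eighths_of_outer_simple_of_oneSided`)
  — no SLE(κ, ρ), no martingale of Lemmas 8.9–8.10, no comparison sentence;
* both one-sided inputs from ONE two-sided restriction measure of exponent `1` whose samples have
  interior points (`…_of_exists_one_interior`), hence from the single named fact
  `exists_isRestrictionMeasure_ae_interior_nonempty` (the existential interior form of [LSW]
  Thm. 7.3, at `α = 1`; `…_of_thm73`), hence **from the three §7 leaves**
  `exists_isBrownianBubbleMeasure_ae_interior_nonempty`, `SLEBubbles.ae_mem_restrictionConfigs`,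
  `SLEBubbles.lintegral_poissonAvoidance_eq_rpow` (`…_of_three_leaves`): the Cor. 8.6 input,
  Cor. 8.6, Prop. 8.1, p. 5 result 1 (`exists_isRestrictionMeasure_iff_of_three_leaves`), p. 5
  result 2 in both readings and `LawlerSchrammWerner2003_of_three_leaves` — previously five leaves
  (`…_of_five_leaves`, `ConformalRestrictionFiveLeaves` / `RestrictionMeasuresExistenceHolds`), the
  two §8 leaves `SLEKappaRho.exists_isOneSidedMartingale` and
  `SLEKappaRho.measure_I_notMem_fill_lt_of_neg` being no longer needed for them.

Do not feed `exists_isRestrictionMeasure_iff` in as the source of `P_1`: its "only if" half is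
Cor. 8.6, whose discharge runs through this file.

Mathlib: `ENNReal.eq_div_iff`. Tree: the theorems quoted above.

## References

* [LSW] Prop. 8.1 (§8.2), §8.1 (p. 31), Cor. 8.6 (pp. 37–38), p. 5 results 1–2, Thm. 7.3 (p. 29).
  [LawlerSchrammWerner2003Restriction]
* G. F. Lawler, *Conformally Invariant Processes in the Plane*, AMS (2005), Cor. 9.11 (p. 219),
  §9.2 Prop. 9.13 (p. 220). [Lawler2005]
-/

noncomputable section

open Set MeasureTheory
open scoped ENNReal

namespace Literature.Probability.RandomPlanarGeometry

open RestrictionConfig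

/-! ### `q(5/8) = 1/2` unconditionally -/

/-- **`P⁺_{5/8}{i ∉ K} = 1/2`** for every right-sided restriction measure of exponent `5/8`
([Law05] proof of Cor. 9.11: "Since the hull corresponding to `α = 5/8` is an SLE_{8/3} curve,
and the distribution of SLE_{8/3} is symmetric about the imaginary axis, `q(5/8) = 1/2`"; [LSW]
p. 38: "which is `1/2` by symmetry"), unconditionally: `P_{5/8}` exists
(`exists_isRestrictionMeasure_five_eighths`, Thm. 6.1), `Q = F^{ℝ₊}_ℍ(P_{5/8})` by uniqueness of
`P⁺_{5/8}`, `Q{i ∉ K} = P_{5/8}(i right of K) = r` with `2r + P_{5/8}(i ∈ K) = 1` and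
`P_{5/8}(i ∈ K) = 0` (the SLE_{8/3} curve misses `i`).
[cite: Lawler2005, Cor. 9.11 (proof, p. 219)] -/
theorem IsRightRestrictionMeasure.measure_I_notMem_eq_half_of_five_eighths {Q : Measure RightConfig}
    (hQ : IsRightRestrictionMeasure (5 / 8) Q) :
    Q {K : RightConfig | Complex.I ∉ (K : Set ℂ)} = 1 / 2 := by
  obtain ⟨P, hP⟩ := exists_isRestrictionMeasure_five_eighths
  rw [hQ.unique hP.map_leftFillConfig, hP.map_leftFillConfig_setOf_notMem]
  have h := hP.two_mul_measure_rightOf_I_add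
  rw [hP.measure_setOf_I_mem_eq_zero_of_five_eighths, add_zero] at h
  exact (ENNReal.eq_div_iff two_ne_zero ENNReal.ofNat_ne_top).2 h

/-! ### The fact, the asymmetry and Cor. 8.6 from existence and positivity alone -/

/-- **`P⁺_α{i ∉ K} > 1/2` for every `P⁺_α`, `α < 5/8`, from existence of all `P⁺_β` and the
small-`β` positivity** (Lawler's Cor. 9.11 argument, `IsRightRestrictionMeasure.one_half_lt_measure_notMem_I_of_pos`,
with its input `q(5/8) = 1/2` discharged). [cite: Lawler2005, Cor. 9.11 (p. 219) and its proof] -/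
theorem IsRightRestrictionMeasure.one_half_lt_measure_notMem_I_of_exists_of_pos
    (hex : exists_isRightRestrictionMeasure)
    (hpos : ∀ ε : ℝ, 0 < ε → ∃ (β : ℝ) (Q : Measure RightConfig), 0 < β ∧ β ≤ ε ∧
      IsRightRestrictionMeasure β Q ∧ Q {K : RightConfig | Complex.I ∉ (K : Set ℂ)} < 1)
    {α : ℝ} {Q : Measure RightConfig} (hQ : IsRightRestrictionMeasure α Q) (hlt : α < 5 / 8) :
    1 / 2 < Q {K : RightConfig | Complex.I ∉ (K : Set ℂ)} :=
  IsRightRestrictionMeasure.one_half_lt_measure_notMem_I_of_pos hex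
    (fun hQ' ↦ hQ'.measure_I_notMem_eq_half_of_five_eighths) hpos hQ hlt

/-- **The Cor. 8.6 input `exists_isRightRestrictionMeasure_lt_five_eighths` from existence of all
`P⁺_β` ([LSW] Prop. 8.1) and the small-`β` positivity** — the two one-sided inputs of Lawler's
proof, `q(5/8) = 1/2` being a theorem. [cite: Lawler2005, Cor. 9.11 (p. 219) and its proof; LawlerSchrammWerner2003Restriction, proof of Cor. 8.6 (p. 38)] -/
theorem exists_isRightRestrictionMeasure_lt_five_eighths_of_exists_of_pos'
    (hex : exists_isRightRestrictionMeasure)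
    (hpos : ∀ ε : ℝ, 0 < ε → ∃ (β : ℝ) (Q : Measure RightConfig), 0 < β ∧ β ≤ ε ∧
      IsRightRestrictionMeasure β Q ∧ Q {K : RightConfig | Complex.I ∉ (K : Set ℂ)} < 1) :
    exists_isRightRestrictionMeasure_lt_five_eighths :=
  exists_isRightRestrictionMeasure_lt_five_eighths_of_exists_of_pos hex
    (fun hQ' ↦ hQ'.measure_I_notMem_eq_half_of_five_eighths) hpos

/-- **[LSW] Cor. 8.6 from existence of all `P⁺_β` and the small-`β` positivity** ([Law05]
Cor. 9.11, whose printed proof this is: "if `P_α` exists, the measure is symmetric about the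
imaginary axis, and hence the probability that `i` is contained in the left-filled hull must be at
least `1/2`" — `not_exists_isRestrictionMeasure_of_lt_five_eighths_of_oneSided`).
[cite: Lawler2005, Cor. 9.11 (p. 219); LawlerSchrammWerner2003Restriction, Cor. 8.6 (pp. 37–38)] -/
theorem not_exists_isRestrictionMeasure_of_lt_five_eighths_of_exists_of_pos
    (hex : exists_isRightRestrictionMeasure)
    (hpos : ∀ ε : ℝ, 0 < ε → ∃ (β : ℝ) (Q : Measure RightConfig), 0 < β ∧ β ≤ ε ∧
      IsRightRestrictionMeasure β Q ∧ Q {K : RightConfig | Complex.I ∉ (K : Set ℂ)} < 1) :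
    not_exists_isRestrictionMeasure_of_lt_five_eighths :=
  not_exists_isRestrictionMeasure_of_lt_five_eighths_of_oneSided
    (exists_isRightRestrictionMeasure_lt_five_eighths_of_exists_of_pos' hex hpos)

/-- **[LSW] p. 5 result 2, first sentence (outer reading), from existence of all `P⁺_β` and the
small-`β` INTERIOR positivity** `P⁺_β{i ∈ int K} > 0` — the one-sided route of
`IsRestrictionMeasure.eq_five_eighths_of_outer_simple_of_oneSided` with Cor. 8.6 now supplied by
the same two inputs (`pos_of_intPos`). No §7, no SLE(κ, ρ).
[cite: LawlerSchrammWerner2003Restriction, p. 5 result 2; Cor. 8.6 (pp. 37–38), §8.1–8.2] -/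
theorem IsRestrictionMeasure.eq_five_eighths_of_outer_simple_of_exists_of_intPos
    (hex : exists_isRightRestrictionMeasure)
    (hint : ∀ ε : ℝ, 0 < ε → ∃ (β : ℝ) (Q : Measure RightConfig), 0 < β ∧ β ≤ ε ∧
      IsRightRestrictionMeasure β Q ∧ Q {K : RightConfig | Complex.I ∈ interior (K : Set ℂ)} ≠ 0) :
    IsRestrictionMeasure.eq_five_eighths_of_outer_simple :=
  IsRestrictionMeasure.eq_five_eighths_of_outer_simple_of_oneSided
    (not_exists_isRestrictionMeasure_of_lt_five_eighths_of_exists_of_pos hex (pos_of_intPos hint))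
    hex hint

/-- The almost-everywhere reading (`IsRestrictionMeasure.eq_five_eighths_of_simple`) from the same
two one-sided inputs. [cite: LawlerSchrammWerner2003Restriction, p. 5 result 2; Cor. 8.6 (pp. 37–38), §8.1–8.2] -/
theorem IsRestrictionMeasure.eq_five_eighths_of_simple_of_exists_of_intPos
    (hex : exists_isRightRestrictionMeasure)
    (hint : ∀ ε : ℝ, 0 < ε → ∃ (β : ℝ) (Q : Measure RightConfig), 0 < β ∧ β ≤ ε ∧
      IsRightRestrictionMeasure β Q ∧ Q {K : RightConfig | Complex.I ∈ interior (K : Set ℂ)} ≠ 0) :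
    IsRestrictionMeasure.eq_five_eighths_of_simple :=
  IsRestrictionMeasure.eq_five_eighths_of_simple_of_outer
    (IsRestrictionMeasure.eq_five_eighths_of_outer_simple_of_exists_of_intPos hex hint)

/-- **`LawlerSchrammWerner2003` (chordal restriction + simple curves ⇒ SLE_{8/3}) from existence of
all `P⁺_β` and the small-`β` interior positivity.**
[cite: LawlerSchrammWerner2003Restriction, p. 5 result 2; Prop. 3.3, Thm. 6.1, Cor. 8.6, §8.1–8.2] -/
theorem LawlerSchrammWerner2003_of_exists_of_intPos
    (hex : exists_isRightRestrictionMeasure)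
    (hint : ∀ ε : ℝ, 0 < ε → ∃ (β : ℝ) (Q : Measure RightConfig), 0 < β ∧ β ≤ ε ∧
      IsRightRestrictionMeasure β Q ∧ Q {K : RightConfig | Complex.I ∈ interior (K : Set ℂ)} ≠ 0) :
    LawlerSchrammWerner2003 :=
  LawlerSchrammWerner2003_of_five_eighths
    (IsRestrictionMeasure.eq_five_eighths_of_outer_simple_of_exists_of_intPos hex hint)

/-! ### … from one two-sided restriction measure of exponent `1` with interior points -/

/-- **[LSW] Prop. 8.1 (`exists_isRightRestrictionMeasure`) from the existence of a two-sided
restriction measure of exponent `1`**: the left-filled Poissonian cloud of hung samples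
([Law05] Thm. 9.8 / Prop. 9.13, `ExcursionCloud.exists_isRightRestrictionMeasure_of_exists_one`).
[cite: Lawler2005, §9.2 Prop. 9.13 (p. 220); LawlerSchrammWerner2003Restriction, Prop. 8.1 (§8.2)] -/
theorem exists_isRightRestrictionMeasure_of_exists_restrictionMeasure_one
    (h1 : ∃ P : Measure RestrictionConfig, IsRestrictionMeasure 1 P) :
    exists_isRightRestrictionMeasure := fun _ hβ ↦
  ExcursionCloud.exists_isRightRestrictionMeasure_of_exists_one h1 hβ

/-- **The Cor. 8.6 input from one two-sided restriction measure of exponent `1` almost every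
sample of which has an interior point** (existence by the excursion cloud, positivity by
`ExcursionCloud.small_exponent_positivity`, `q(5/8) = 1/2` by Thm. 6.1).
[cite: Lawler2005, Cor. 9.11 (p. 219) with §9.2 Prop. 9.13 (p. 220)] -/
theorem exists_isRightRestrictionMeasure_lt_five_eighths_of_exists_one_interior
    (h1 : ∃ P : Measure RestrictionConfig, IsRestrictionMeasure 1 P ∧
      ∀ᵐ K : RestrictionConfig ∂P, (interior (K : Set ℂ)).Nonempty) :
    exists_isRightRestrictionMeasure_lt_five_eighths :=
  exists_isRightRestrictionMeasure_lt_five_eighths_of_exists_of_pos'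
    (exists_isRightRestrictionMeasure_of_exists_restrictionMeasure_one (h1.imp fun _ h ↦ h.1))
    (ExcursionCloud.small_exponent_positivity h1)

/-- **[LSW] Cor. 8.6 from one two-sided restriction measure of exponent `1` with interior
points** ([Law05] Cor. 9.11 as printed, the "construction above" being the excursion cloud).
[cite: Lawler2005, Cor. 9.11 (p. 219); LawlerSchrammWerner2003Restriction, Cor. 8.6 (pp. 37–38)] -/
theorem not_exists_isRestrictionMeasure_of_lt_five_eighths_of_exists_one_interior
    (h1 : ∃ P : Measure RestrictionConfig, IsRestrictionMeasure 1 P ∧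
      ∀ᵐ K : RestrictionConfig ∂P, (interior (K : Set ℂ)).Nonempty) :
    not_exists_isRestrictionMeasure_of_lt_five_eighths :=
  not_exists_isRestrictionMeasure_of_lt_five_eighths_of_oneSided
    (exists_isRightRestrictionMeasure_lt_five_eighths_of_exists_one_interior h1)

/-! ### … from the existential interior form of Thm. 7.3 (one named fact) -/

/-- **[LSW] Prop. 8.1 from `exists_isRestrictionMeasure_ae_interior_nonempty`** (at `α = 1`).
[cite: LawlerSchrammWerner2003Restriction, Prop. 8.1 (§8.2) with Thm. 7.3 (p. 29)] -/
theorem exists_isRightRestrictionMeasure_of_thm73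
    (h73 : exists_isRestrictionMeasure_ae_interior_nonempty) : exists_isRightRestrictionMeasure :=
  exists_isRightRestrictionMeasure_of_exists_restrictionMeasure_one
    ((h73 1 (by norm_num)).imp fun _ h ↦ h.1)

/-- **The Cor. 8.6 input from `exists_isRestrictionMeasure_ae_interior_nonempty`** (at `α = 1`).
[cite: LawlerSchrammWerner2003Restriction, Cor. 8.6 (pp. 37–38) with Thm. 7.3 (p. 29); Lawler2005, Cor. 9.11] -/
theorem exists_isRightRestrictionMeasure_lt_five_eighths_of_thm73
    (h73 : exists_isRestrictionMeasure_ae_interior_nonempty) :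
    exists_isRightRestrictionMeasure_lt_five_eighths :=
  exists_isRightRestrictionMeasure_lt_five_eighths_of_exists_one_interior (h73 1 (by norm_num))

/-- **[LSW] Cor. 8.6 from `exists_isRestrictionMeasure_ae_interior_nonempty`.**
[cite: LawlerSchrammWerner2003Restriction, Cor. 8.6 (pp. 37–38) with Thm. 7.3 (p. 29); Lawler2005, Cor. 9.11] -/
theorem not_exists_isRestrictionMeasure_of_lt_five_eighths_of_thm73
    (h73 : exists_isRestrictionMeasure_ae_interior_nonempty) :
    not_exists_isRestrictionMeasure_of_lt_five_eighths :=
  not_exists_isRestrictionMeasure_of_lt_five_eighths_of_oneSided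
    (exists_isRightRestrictionMeasure_lt_five_eighths_of_thm73 h73)

/-- **[LSW] p. 5 result 1 (`exists_isRestrictionMeasure_iff`) from the single named fact
`exists_isRestrictionMeasure_ae_interior_nonempty`** (Cor. 8.6 by the above, `α ≥ 5/8` by
`exists_isRestrictionMeasure_iff_of_cor86_of_thm73`).
[cite: LawlerSchrammWerner2003Restriction, p. 5 result 1; Thm. 7.3 (p. 29), Cor. 8.6 (p. 37)] -/
theorem exists_isRestrictionMeasure_iff_of_thm73
    (h73 : exists_isRestrictionMeasure_ae_interior_nonempty) : exists_isRestrictionMeasure_iff :=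
  exists_isRestrictionMeasure_iff_of_cor86_of_thm73
    (not_exists_isRestrictionMeasure_of_lt_five_eighths_of_thm73 h73) h73

/-! ### … from the three §7 leaves -/

/-- **[LSW] Prop. 8.1 from the three §7 leaves** (bubble measure with interior points,
`Ξ(κ) ∈ Ω` a.s., Theorem 6.5). [cite: LawlerSchrammWerner2003Restriction, Prop. 8.1 (§8.2) with Thm. 7.3 (p. 29)] -/
theorem exists_isRightRestrictionMeasure_of_three_leaves
    (hμex : exists_isBrownianBubbleMeasure_ae_interior_nonempty)
    (hcfg : SLEBubbles.ae_mem_restrictionConfigs)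
    (h65 : SLEBubbles.lintegral_poissonAvoidance_eq_rpow) : exists_isRightRestrictionMeasure :=
  exists_isRightRestrictionMeasure_of_thm73
    (exists_isRestrictionMeasure_ae_interior_nonempty_of_three_leaves hμex hcfg h65)

/-- **The Cor. 8.6 input `exists_isRightRestrictionMeasure_lt_five_eighths` from the three §7
leaves.** Its discharge is this theorem applied to the three `_holds` theorems, once they exist.
[cite: LawlerSchrammWerner2003Restriction, Cor. 8.6 (pp. 37–38) with Thm. 7.3 (p. 29); Lawler2005, Cor. 9.11] -/
theorem exists_isRightRestrictionMeasure_lt_five_eighths_of_three_leaves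
    (hμex : exists_isBrownianBubbleMeasure_ae_interior_nonempty)
    (hcfg : SLEBubbles.ae_mem_restrictionConfigs)
    (h65 : SLEBubbles.lintegral_poissonAvoidance_eq_rpow) :
    exists_isRightRestrictionMeasure_lt_five_eighths :=
  exists_isRightRestrictionMeasure_lt_five_eighths_of_thm73
    (exists_isRestrictionMeasure_ae_interior_nonempty_of_three_leaves hμex hcfg h65)

/-- **[LSW] Cor. 8.6 from the three §7 leaves.** [cite: LawlerSchrammWerner2003Restriction, Cor. 8.6 (pp. 37–38) with Thm. 7.3 (p. 29)] -/
theorem not_exists_isRestrictionMeasure_of_lt_five_eighths_of_three_leaves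
    (hμex : exists_isBrownianBubbleMeasure_ae_interior_nonempty)
    (hcfg : SLEBubbles.ae_mem_restrictionConfigs)
    (h65 : SLEBubbles.lintegral_poissonAvoidance_eq_rpow) :
    not_exists_isRestrictionMeasure_of_lt_five_eighths :=
  not_exists_isRestrictionMeasure_of_lt_five_eighths_of_thm73
    (exists_isRestrictionMeasure_ae_interior_nonempty_of_three_leaves hμex hcfg h65)

/-- **[LSW] p. 5 result 1 from the three §7 leaves** (previously five,
`exists_isRestrictionMeasure_iff_of_five_leaves'`). [cite: LawlerSchrammWerner2003Restriction, p. 5 result 1; Thm. 7.3 (p. 29), Cor. 8.6 (p. 37)] -/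
theorem exists_isRestrictionMeasure_iff_of_three_leaves
    (hμex : exists_isBrownianBubbleMeasure_ae_interior_nonempty)
    (hcfg : SLEBubbles.ae_mem_restrictionConfigs)
    (h65 : SLEBubbles.lintegral_poissonAvoidance_eq_rpow) : exists_isRestrictionMeasure_iff :=
  exists_isRestrictionMeasure_iff_of_thm73
    (exists_isRestrictionMeasure_ae_interior_nonempty_of_three_leaves hμex hcfg h65)

/-- **[LSW] p. 5 result 2, first sentence (outer reading), from the three §7 leaves** (previously
five, `IsRestrictionMeasure.eq_five_eighths_of_outer_simple_of_five_leaves`): Cor. 8.6 by the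
above and the interior-point form of Thm. 7.3
(`IsRestrictionMeasure.ae_interior_nonempty_of_gt_five_eighths_of_three_leaves`).
[cite: LawlerSchrammWerner2003Restriction, p. 5 result 2; Thm. 7.3 (p. 29), Cor. 8.6 (pp. 37–38)] -/
theorem IsRestrictionMeasure.eq_five_eighths_of_outer_simple_of_three_leaves
    (hμex : exists_isBrownianBubbleMeasure_ae_interior_nonempty)
    (hcfg : SLEBubbles.ae_mem_restrictionConfigs)
    (h65 : SLEBubbles.lintegral_poissonAvoidance_eq_rpow) :
    IsRestrictionMeasure.eq_five_eighths_of_outer_simple :=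
  IsRestrictionMeasure.eq_five_eighths_of_outer_simple_of_facts
    (not_exists_isRestrictionMeasure_of_lt_five_eighths_of_three_leaves hμex hcfg h65)
    (IsRestrictionMeasure.ae_interior_nonempty_of_gt_five_eighths_of_three_leaves hμex hcfg h65)

/-- The almost-everywhere reading from the three §7 leaves. [cite: LawlerSchrammWerner2003Restriction, p. 5 result 2; Thm. 7.3 (p. 29), Cor. 8.6 (pp. 37–38)] -/
theorem IsRestrictionMeasure.eq_five_eighths_of_simple_of_three_leaves
    (hμex : exists_isBrownianBubbleMeasure_ae_interior_nonempty)
    (hcfg : SLEBubbles.ae_mem_restrictionConfigs)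
    (h65 : SLEBubbles.lintegral_poissonAvoidance_eq_rpow) :
    IsRestrictionMeasure.eq_five_eighths_of_simple :=
  IsRestrictionMeasure.eq_five_eighths_of_simple_of_outer
    (IsRestrictionMeasure.eq_five_eighths_of_outer_simple_of_three_leaves hμex hcfg h65)

/-- **`LawlerSchrammWerner2003` from the three §7 leaves** (previously five,
`LawlerSchrammWerner2003_of_five_leaves`): the martingale of [LSW] Lemmas 8.9–8.10 and the
comparison sentence of p. 38 are no longer needed.
[cite: LawlerSchrammWerner2003Restriction, p. 5 result 2; Prop. 3.3, Thm. 6.1, Thm. 7.3, Cor. 8.6] -/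
theorem LawlerSchrammWerner2003_of_three_leaves
    (hμex : exists_isBrownianBubbleMeasure_ae_interior_nonempty)
    (hcfg : SLEBubbles.ae_mem_restrictionConfigs)
    (h65 : SLEBubbles.lintegral_poissonAvoidance_eq_rpow) : LawlerSchrammWerner2003 :=
  LawlerSchrammWerner2003_of_five_eighths
    (IsRestrictionMeasure.eq_five_eighths_of_outer_simple_of_three_leaves hμex hcfg h65)

end Literature.Probability.RandomPlanarGeometry

end
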